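import Literature.NumberTheory.Automorphic.CuspidalWhittakerGL2
import Literature.NumberTheory.Automorphic.GlobalWhittakerCoefficientProofs
import HarnessLib

/-!
# Inputs for the Fourier–Whittaker expansion of cusp forms on `GL₂(𝔸_K)`
(Cogdell (2004), §1.1, Thm. 1.1 for `n = 2`: cuspidality along `N₂`, the classification of the
global additive characters, and the index set `N₁(K) \ GL₁(K) = Kˣ`)

Topic `NumberTheory/Automorphic`; namespace `Literature.NumberTheory.Automorphic`. Four inputs of
the proof of the named fact `Shalika1974_fourierExpansion_cuspForm` (`GlobalWhittakerCoefficient`)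
in rank `n = 2`, all PROVED:

* `setIntegral_unipotentTateDomain_mul_eq_zero_of_cuspConditionGL` — **cuspidality along `N₂`**:
  the Borel–Jacquet cusp condition `CuspConditionGL 2 K φ 1` (vanishing of
  `∫ φ((1 + X) g) dX` over a fundamental domain of `𝔫₁(K)` in `𝔫₁(𝔸_K)` for every additive Haar
  measure) gives `∫_{𝓕_N} φ(u g) dν(u) = 0` for every Haar measure `ν` on `N₂(𝔸_K)` and Tate's box
  `𝓕_N` (transport along the homeomorphic isomorphism `u ↦ (0 u₀₁; 0 0)`, `1 + (0 u₀₁; 0 0) = u`,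
  which maps `ν` to an additive Haar measure and `𝓕_N` onto the block fundamental domain);
* `IsGlobalAddChar.exists_eq_mulShift` — **every global additive character is a rational dilate
  of Tate's**: `ψ = ψ_K(η ·)` for some `η ∈ Kˣ` (the dual form of Tate's Thm. 4.1.4: a continuous
  character of `𝔸_K ⧸ K` distinct from all `ψ_ξ`, `ξ ∈ K`, is orthogonal to them
  (`integral_conj_addChar_mul_addChar`), hence zero by their completeness
  (`eq_zero_of_forall_integral_conj_adeleQuotChar_mul_eq_zero`), which is absurd);
* `whittakerCoeff_mulShift_eq_whittakerCoeff_ratDiagGL2_mul` — **changing `ψ` is a rational torus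
  translate**: `W^{ψ_K(η ·)}_φ(h) = W^{ψ_K}_φ(d(η) h)` over Tate's box (Cogdell (2004), §1.1:
  "`W_{φ,ψ_γ}(g) = W_{φ,ψ}(diag(γ, 1) g)`");
* `glCorner_map_eq_ratDiagGL2` and `exists_equiv_quotient_upperUnitriangular_one` — **the index
  set**: the corner embedding of `a ∈ GL₁(K)` is `d(a) = diag(a, 1)`, and `GL₁(K) ⧸ N₁(K) ≃ Kˣ` by
  `δ ↦ det δ.out` (`N₁(K) = 1`).

## References

* J. W. Cogdell, *Analytic theory of L-functions for GL_n*, in: J. Bernstein, S. Gelbart (eds.),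
  *An Introduction to the Langlands Program* (2004), §1.1, Thm. 1.1 (PDF pp. 175–176 of the held
  copy) [CogdellAnalyticTheory2004].
* J. Tate, in Cassels–Fröhlich (eds.), *Algebraic Number Theory* (1967), Ch. XV, Thm. 4.1.4
  [CasselsFrohlichANT1967].
-/

noncomputable section

open _root_.MeasureTheory _root_.MeasureTheory.Measure Set Filter IsDedekindDomain NumberField Matrix
open _root_.Topology
open scoped MatrixGroups ENNReal ComplexConjugate

namespace Literature.NumberTheory.Automorphic

variable {K : Type} [Field K] [NumberField K]

/-! ### Cuspidality along `N₂` on Tate's box -/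

section Cusp

variable [MeasurableSpace ↥(adelicUnipotent 2 K)] [BorelSpace ↥(adelicUnipotent 2 K)]

/-- `1 + (0 x; 0 0) = n(x)` (`unipotentOfBlock` of `GLnCuspidalSpectrum` against `unipotentGL2` of
`WhittakerBesselGL2`). [folklore] -/
theorem unipotentOfBlock_ofAdd_blockOfEntryGL2 {R : Type*} [CommRing R] (x : R) :
    unipotentOfBlock 2 1 R (Multiplicative.ofAdd (blockOfEntryGL2 x)) =
      ((unipotentGL2 x : ↥(upperUnitriangular (Fin 2) R)) : GL (Fin 2) R) := by
  have h := unipotentOfBlock_negBlockEquivGL2 (-x)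
  rwa [negBlockEquivGL2_apply, neg_neg] at h

/-- **Cuspidality along `N₂` on Tate's box.** If the constant term of `φ : GL₂(𝔸_K) → ℂ` along the
Borel subgroup vanishes in the sense of Borel–Jacquet (`CuspConditionGL 2 K φ 1`: for every
additive Haar measure on `𝔫₁(𝔸_K)` and every fundamental domain of `𝔫₁(K)`), then for every Haar
measure `ν` on `N₂(𝔸_K)` and every `g`, `∫_{𝓕_N} φ(u g) dν(u) = 0` on Tate's box
`𝓕_N = unipotentTateDomain 2 K`: transport along `Ψ : u ↦ (0 u₀₁; 0 0)`, a homeomorphic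
isomorphism `N₂(𝔸_K) ≅ 𝔫₁(𝔸_K)` with `1 + Ψ(u) = u`, `ν ↦ Ψ_* ν` additive Haar
(`isAddHaarMeasure_entryMeasure`, `AddEquiv.isAddHaarMeasure_map`) and
`Ψ⁻¹(block fundamental domain) = 𝓕_N`. (Cogdell (2004), §1.1: "Since `φ` is cuspidal,
`∫_{k\𝔸} φ(n(x) g) dx ≡ 0`".) [cite: CogdellAnalyticTheory2004, §1.1] -/
theorem setIntegral_unipotentTateDomain_mul_eq_zero_of_cuspConditionGL
    {φ : GL (Fin 2) (AdeleRing (𝓞 K) K) → ℂ} (hcusp : CuspConditionGL 2 K φ 1)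
    (ν : Measure ↥(adelicUnipotent 2 K)) [IsHaarMeasure ν] (g : GL (Fin 2) (AdeleRing (𝓞 K) K)) :
    ∫ u in unipotentTateDomain 2 K, φ ((u : GL (Fin 2) (AdeleRing (𝓞 K) K)) * g) ∂ν = 0 := by
  borelize (AdeleRing (𝓞 K) K)
  -- the additive isomorphism `x ↦ (0 x; 0 0)` and the homeomorphism `Ψ`
  set e : AdeleRing (𝓞 K) K ≃+ blockNilpotent 2 1 (AdeleRing (𝓞 K) K) :=
    (negBlockEquivGL2 (R := AdeleRing (𝓞 K) K)).trans (AddEquiv.neg _) with he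
  have he_apply : ∀ x, e x = blockOfEntryGL2 x := fun x => by
    change -(negBlockEquivGL2 x) = _
    rw [← map_neg, negBlockEquivGL2_apply, neg_neg]
  have hec : Continuous e := by
    change Continuous fun x => -(negBlockEquivGL2 (R := AdeleRing (𝓞 K) K) x)
    exact continuous_negBlockEquivGL2.neg
  have hesc : Continuous e.symm := by
    change Continuous fun y => (negBlockEquivGL2 (R := AdeleRing (𝓞 K) K)).symm (-y)
    exact continuous_negBlockEquivGL2_symm.comp continuous_neg
  set Ψ : ↥(adelicUnipotent 2 K) ≃ₜ blockNilpotent 2 1 (AdeleRing (𝓞 K) K) :=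
    (unipotentHomeomorphGL2 (R := AdeleRing (𝓞 K) K)).symm.trans
      { toEquiv := e.toEquiv, continuous_toFun := hec, continuous_invFun := hesc } with hΨ
  have hΨ_apply : ∀ u : ↥(adelicUnipotent 2 K), Ψ u = blockOfEntryGL2
      ((((u : GL (Fin 2) (AdeleRing (𝓞 K) K)) : Matrix (Fin 2) (Fin 2) (AdeleRing (𝓞 K) K)) 0 1)) :=
    fun u => he_apply _
  have hglU : ∀ u : ↥(adelicUnipotent 2 K),
      glUnipotent 2 1 K (Multiplicative.ofAdd (Ψ u)) = (u : GL (Fin 2) (AdeleRing (𝓞 K) K)) :=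
    fun u => by
    rw [hΨ_apply, glUnipotent_apply, unipotentOfBlock_ofAdd_blockOfEntryGL2, unipotentGL2_entry]
  -- the transported measure is an additive Haar measure
  have hmap : ν.map Ψ = (entryMeasure ν).map e := by
    rw [entryMeasure, Measure.map_map hec.measurable measurableEmbedding_entry_zero_one.measurable]
    rfl
  haveI : (ν.map Ψ).IsAddHaarMeasure := by
    rw [hmap]
    exact AddEquiv.isAddHaarMeasure_map _ e hec hesc
  -- the preimage of the block fundamental domain is Tate's box
  have hpre : Ψ ⁻¹' blockFundamentalDomain 2 1 K = unipotentTateDomain 2 K := by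
    ext u
    rw [mem_preimage, mem_blockFundamentalDomain, mem_unipotentTateDomain_iff, hΨ_apply,
      coe_blockOfEntryGL2]
    have h0 := zero_mem_adeleFundamentalDomain K
    constructor
    · intro h i j hij
      fin_cases i <;> fin_cases j
      · exact absurd hij (lt_irrefl _)
      · simpa using h 0 1
      · exact absurd hij (by decide)
      · exact absurd hij (lt_irrefl _)
    · intro h i j
      fin_cases i <;> fin_cases j
      · simpa using h0
      · simpa using h 0 1 (by decide)
      · simpa using h0
      · simpa using h0
  -- the cusp condition on the transported datum
  have h := (hcusp (ν.map Ψ) (blockFundamentalDomain 2 1 K)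
    (isAddFundamentalDomain_blockFundamentalDomain 2 1 K _) g).2
  rw [Ψ.measurableEmbedding.setIntegral_map, hpre] at h
  simp_rw [hglU] at h
  exact h

end Cusp

/-! ### Global additive characters are rational dilates of Tate's character -/

section Characters

/-- **Every global additive character is a rational dilate of Tate's character** (dual form of
Tate's Thm. 4.1.4, `K^⊥ = K`): if `ψ : 𝔸_K → 𝕊` is continuous, trivial on `K` and non-trivial, then
`ψ = ψ_K(η ·)` for some `η ∈ K`, `η ≠ 0`. Proof: `ψ` descends to a continuous character `χ` of the
compact group `𝔸_K ⧸ K`; if `χ ≠ ψ_ξ` for all `ξ ∈ K` then `∫ conj ψ_ξ · χ = 0` for all `ξ`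
(orthogonality of distinct characters) and `χ = 0` by the completeness of the `ψ_ξ`
(`eq_zero_of_forall_integral_conj_adeleQuotChar_mul_eq_zero`), contradicting `χ(0) = 1`.
[cite: CasselsFrohlichANT1967, Ch. XV Thm. 4.1.4] -/
theorem IsGlobalAddChar.exists_eq_mulShift {ψ : AddChar (AdeleRing (𝓞 K) K) Circle}
    (hψ : IsGlobalAddChar K ψ) :
    ∃ η : K, η ≠ 0 ∧ ψ = (adeleAddChar K).mulShift (algebraMap K (AdeleRing (𝓞 K) K) η) := by
  classical
  borelize (adeleQuotient K)
  -- descend `ψ` to the quotient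
  set χ : AddChar (adeleQuotient K) Circle := AddChar.toAddMonoidHomEquiv.symm
    (QuotientAddGroup.lift (AdeleRing.principalSubgroup (𝓞 K) K) ψ.toAddMonoidHom
      (by
        rintro _ ⟨k, rfl⟩
        rw [AddMonoidHom.mem_ker, AddChar.toAddMonoidHom_apply]
        change Additive.ofMul _ = Additive.ofMul 1
        rw [hψ.map_algebraMap])) with hχdef
  have hχ : ∀ x : AdeleRing (𝓞 K) K, χ (QuotientAddGroup.mk x) = ψ x := fun x => rfl
  have hχc : Continuous fun u : adeleQuotient K => (χ u : ℂ) := by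
    rw [(QuotientAddGroup.isQuotientMap_mk (AdeleRing.principalSubgroup (𝓞 K) K)).continuous_iff]
    exact continuous_subtype_val.comp hψ.continuous
  -- some `ψ_ξ` equals `χ`
  have hex : ∃ ξ : K, adeleQuotChar K ξ = χ := by
    by_contra hne
    push Not at hne
    have hzero : (fun u : adeleQuotient K => (χ u : ℂ)) = 0 := by
      refine eq_zero_of_forall_integral_conj_adeleQuotChar_mul_eq_zero K hχc fun ξ => ?_
      rw [integral_conj_addChar_mul_addChar (adeleQuotHaar K) (adeleQuotChar K ξ) χ, if_neg (hne ξ)]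
    have h1 := congrFun hzero 0
    rw [AddChar.map_zero_eq_one, Circle.coe_one, Pi.zero_apply] at h1
    exact one_ne_zero h1
  obtain ⟨η, hη⟩ := hex
  have hψη : ψ = (adeleAddChar K).mulShift (algebraMap K (AdeleRing (𝓞 K) K) η) := by
    refine AddChar.ext _ _ fun x => ?_
    rw [AddChar.mulShift_apply, ← adeleQuotChar_mk, hη, hχ]
  refine ⟨η, fun h0 => hψ.ne_one ?_, hψη⟩
  rw [hψη, h0, map_zero, AddChar.mulShift_zero]

end Characters

/-! ### Changing the character is a rational torus translate -/

section MulShift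

variable [MeasurableSpace ↥(adelicUnipotent 2 K)] [BorelSpace ↥(adelicUnipotent 2 K)]
  [MeasurableSpace (AdeleRing (𝓞 K) K)] [BorelSpace (AdeleRing (𝓞 K) K)]
  [MeasurableSpace (adeleQuotient K)] [BorelSpace (adeleQuotient K)]

/-- **`W_{φ,ψ_η}(h) = W_{φ,ψ}(d(η) h)`** (Cogdell (2004), §1.1: "An elementary calculation shows
that `W_{φ,ψ_γ}(g) = W_{φ,ψ}(diag(γ, 1) g)` if `γ ≠ 0`"): for `φ` continuous and left
`GL₂(K)`-invariant, `ψ_K` Tate's character, `η ∈ Kˣ` and any Haar measure `ν` on `N₂(𝔸_K)`, the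
Whittaker coefficient over Tate's box for the dilated character `ψ_K(η ·)` at `h` is the one for
`ψ_K` at `d(η) h` — both are the `η`-th Fourier coefficient of `x + K ↦ φ(n(x) h)`
(`integral_mul_unipotentPeriodization`, `integral_conj_adeleQuotChar_mul_unipotentPeriodization`).
[cite: CogdellAnalyticTheory2004, §1.1] -/
theorem whittakerCoeff_mulShift_eq_whittakerCoeff_ratDiagGL2_mul
    {φ : GL (Fin 2) (AdeleRing (𝓞 K) K) → ℂ} (hφ : IsLeftInvariant (AdelicGroupData.gl 2 K) φ)
    (hφc : Continuous φ) (ν : Measure ↥(adelicUnipotent 2 K)) [IsHaarMeasure ν] (η : Kˣ)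
    (h : GL (Fin 2) (AdeleRing (𝓞 K) K)) :
    whittakerCoeff ν (unipotentTateDomain 2 K)
        ((adeleAddChar K).mulShift (algebraMap K (AdeleRing (𝓞 K) K) η)) φ h =
      whittakerCoeff ν (unipotentTateDomain 2 K) (adeleAddChar K) φ (ratDiagGL2 K η * h) := by
  rw [← integral_conj_adeleQuotChar_mul_unipotentPeriodization hφ hφc ν η h,
    integral_mul_unipotentPeriodization hφ hφc ν (F := fun q => conj (adeleQuotChar K (η : K) q : ℂ))
      (continuous_adeleQuotChar K (η : K)).star h, whittakerCoeff_def]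
  congr 1
  refine setIntegral_congr_fun measurableSet_unipotentTateDomain fun u _ => ?_
  simp only [adeleQuotChar_mk, whittakerCharFun_fin_two, AddChar.mulShift_apply, mul_comm]

end MulShift

/-! ### The index set `GL₁(K) ⧸ N₁(K) ≃ Kˣ` and the corner embedding -/

section Index

/-- **The corner embedding of `GL₁` into `GL₂` is the torus element `diag(a, 1)`**:
`glCorner R _ a = d(det a, 1)` (`diagGL2`) for `a ∈ GL₁(R)` (`det a = a₀₀`). [folklore] -/
theorem glCorner_one_eq_diagGL2 {R : Type*} [CommRing R] (h12 : 1 ≤ 2) (a : GL (Fin 1) R) :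
    glCorner R h12 a = diagGL2 (Matrix.GeneralLinearGroup.det a) 1 := by
  have h0 : (finBlockEquiv h12 (Sum.inl 0) : Fin 2) = 0 := Fin.ext (by rw [coe_finBlockEquiv_inl]; rfl)
  have h1 : (finBlockEquiv h12 (Sum.inr 0) : Fin 2) = 1 := Fin.ext (by rw [coe_finBlockEquiv_inr]; rfl)
  have e00 : ((glCorner R h12 a : GL (Fin 2) R) : Matrix (Fin 2) (Fin 2) R) 0 0 =
      (a : Matrix (Fin 1) (Fin 1) R) 0 0 := by
    rw [← h0]; exact glCorner_apply_inl_inl h12 a 0 0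
  have e01 : ((glCorner R h12 a : GL (Fin 2) R) : Matrix (Fin 2) (Fin 2) R) 0 1 = 0 := by
    rw [← h0, ← h1]; exact glCorner_apply_inl_inr h12 a 0 0
  have e10 : ((glCorner R h12 a : GL (Fin 2) R) : Matrix (Fin 2) (Fin 2) R) 1 0 = 0 := by
    rw [← h0, ← h1]; exact glCorner_apply_inr_inl h12 a 0 0
  have e11 : ((glCorner R h12 a : GL (Fin 2) R) : Matrix (Fin 2) (Fin 2) R) 1 1 = 1 := by
    rw [← h1, glCorner_apply_inr_inr h12 a 0 0, Matrix.one_apply_eq]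
  refine Units.ext (Matrix.ext fun i j => ?_)
  rw [coe_diagGL2]
  fin_cases i <;> fin_cases j
  · rw [Fin.zero_eta, e00]
    simp
  · simpa using e01
  · simpa using e10
  · simpa using e11

/-- **The corner embedding of a rational `a ∈ GL₁(K)` into `GL₂(𝔸_K)` is the rational torus
element `d(det a)`** (`ratDiagGL2`). [folklore] -/
theorem glCorner_map_eq_ratDiagGL2 (h12 : 1 ≤ 2) (a : GL (Fin 1) K) :
    glCorner (AdeleRing (𝓞 K) K) h12
        (Matrix.GeneralLinearGroup.map (algebraMap K (AdeleRing (𝓞 K) K)) a) =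
      ratDiagGL2 K (Matrix.GeneralLinearGroup.det a) := by
  rw [glCorner_one_eq_diagGL2, ratDiagGL2]
  congr 1
  refine Units.ext ?_
  rw [Matrix.GeneralLinearGroup.val_det_apply, Matrix.det_fin_one, Units.coe_map,
    MonoidHom.coe_coe, Matrix.GeneralLinearGroup.val_det_apply, Matrix.det_fin_one]
  rfl

omit [NumberField K] in
/-- **`GL₁(K) ⧸ N₁(K) ≃ Kˣ` by `δ ↦ det δ.out`** (`N₁(K)` is trivial,
`subsingleton_upperUnitriangular_of_le_one`; a `1 × 1` invertible matrix is its determinant).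
[folklore] -/
theorem exists_equiv_quotient_upperUnitriangular_one :
    ∃ E : (GL (Fin 1) K ⧸ upperUnitriangular (Fin 1) K) ≃ Kˣ,
      ∀ δ, E δ = Matrix.GeneralLinearGroup.det δ.out := by
  haveI := subsingleton_upperUnitriangular_of_le_one (R := K) (n := 1) le_rfl
  have hdet : ∀ a b : GL (Fin 1) K,
      Matrix.GeneralLinearGroup.det a = Matrix.GeneralLinearGroup.det b → a = b := fun a b hab => by
    refine Units.ext (Matrix.ext fun i j => ?_)
    fin_cases i; fin_cases j
    have h := congrArg Units.val hab
    rw [Matrix.GeneralLinearGroup.val_det_apply, Matrix.GeneralLinearGroup.val_det_apply,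
      Matrix.det_fin_one, Matrix.det_fin_one] at h
    simpa using h
  refine ⟨Equiv.ofBijective (fun δ => Matrix.GeneralLinearGroup.det δ.out) ⟨fun δ δ' h => ?_,
    fun a => ?_⟩, fun δ => rfl⟩
  · rw [← QuotientGroup.out_eq' δ, ← QuotientGroup.out_eq' δ', hdet _ _ h]
  · set g₀ : GL (Fin 1) K := glDiagonal 1 K ![a] with hg₀
    obtain ⟨u, hu⟩ := QuotientGroup.mk_out_eq_mul (upperUnitriangular (Fin 1) K) g₀
    refine ⟨QuotientGroup.mk g₀, ?_⟩
    simp only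
    rw [hu, Subsingleton.elim u 1, OneMemClass.coe_one, mul_one]
    refine Units.ext ?_
    rw [Matrix.GeneralLinearGroup.val_det_apply, Matrix.det_fin_one, hg₀, coe_glDiagonal]
    simp

end Index

end Literature.NumberTheory.Automorphic
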